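import Summits.AtomisticToContinuum.HydrodynamicLimit.Theorems.ImplosionDichotomyEosContinuityReduction
import Literature.MathematicalPhysics.KineticTheory.HardSphereEulerContinuousDependence

/-!
# `ImplosionDichotomy.EosContinuity` — closing theorem, conditional on Kato's continuous dependence

Support item stmt-AtomisticToContinuum-12589 (`EosContinuity`, route `ImplosionDichotomy`, sub-problem
`HydrodynamicLimit`). By `eosContinuity_of_nearIdealStability` (`…EosContinuityReduction.lean`) the item
follows, given what the tree proves (analytic hard-sphere equation of state `hsEosLowDensity_proof`,
small-packing uniqueness, identified law of large numbers with smooth `σ³`-rate, data pinning), from ONE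
deterministic PDE statement about the one-parameter family of hard-sphere Euler systems `p = ρθ Z(ρσ³)`,
`σ → 0`: classical solutions depend continuously, on compact sub-intervals of the life span of the
ideal-gas (`σ = 0`) solution, on the data (in `Cᵏ`) and on the reduced diameter `σ` at `σ = 0`. That
statement is the named Literature fact `hsEuler_continuousDependence` (Kato 1975 Thm III for the
symmetrised hard-sphere Euler family, `HardSphereEulerContinuousDependence.lean`, part (c) of the local
theory whose parts (a) local existence and (b) continuation are `HardSphereEulerLocalTheory.lean`); its
low-density analyticity hypothesis is discharged by `hsEosLowDensity_proof`, and the item is closed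
CONDITIONALLY on it: `eosContinuity_proof`.
-/

noncomputable section

namespace Summit.AtomisticToContinuum.HydrodynamicLimit.Theorems

open Set
open Literature.MathematicalPhysics.KineticTheory Literature.Analysis.FunctionSpaces
open Summit.AtomisticToContinuum.HydrodynamicLimit.Theses.ImplosionDichotomy (EosContinuity)

/-- The near-ideal stability hypothesis of `eosContinuity_of_nearIdealStability` (density datum
perturbed, velocity and temperature data kept) is the special case `θ₀ := θ₁ 0`, `u₀ := u₁ 0` of the
named fact `hsEuler_continuousDependence`, once its equation-of-state hypothesis is discharged by
`hsEosLowDensity_proof` (the unperturbed data are smooth slices of the reference solution and are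
trivially `δ`-close to themselves). [folklore] -/
theorem nearIdealStability_of_continuousDependence (h : hsEuler_continuousDependence) :
    ∀ (T₁ : ℝ) (ρ₁ θ₁ : ℝ → T3 → ℝ) (u₁ : ℝ → T3 → V3),
      IsHardSphereEulerSolution 0 T₁ ρ₁ u₁ θ₁ → ∀ T₂ : ℝ, 0 < T₂ → T₂ < T₁ → ∀ ε : ℝ, 0 < ε →
      ∃ k : ℕ, ∃ δ : ℝ, 0 < δ ∧ ∀ σ : ℝ, 0 < σ → σ < δ →
        ∀ ρ₀ : T3 → ℝ, Torus.IsSmooth ρ₀ → (∀ x, 0 < ρ₀ x) →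
          (∀ n : ℕ, n ≤ k → ∀ y : EuclideanSpace ℝ (Fin 3),
            ‖iteratedFDeriv ℝ n (Torus.lift fun x => ρ₀ x - ρ₁ 0 x) y‖ ≤ δ) →
          ∃ T : ℝ, T₂ < T ∧ ∃ (ρ θ : ℝ → T3 → ℝ) (u : ℝ → T3 → V3),
            IsHardSphereEulerSolution σ T ρ u θ ∧ ρ 0 = ρ₀ ∧ u 0 = u₁ 0 ∧ θ 0 = θ₁ 0 ∧
            ∀ t ∈ Ico 0 T, ∀ x, |ρ t x - ρ₁ t x| < ε := by
  obtain ⟨η₀, hη₀, F, hF, hEq, -⟩ := hsEosLowDensity_proof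
  intro T₁ ρ₁ θ₁ u₁ hE₁ T₂ hT₂ hT₂₁ ε hε
  obtain ⟨k, δ, hδ, H⟩ := h η₀ hη₀ F hF hEq T₁ ρ₁ θ₁ u₁ hE₁ T₂ hT₂ hT₂₁ ε hε
  refine ⟨k, δ, hδ, fun σ hσ hσδ ρ₀ hρ₀ hρ₀pos hdata => ?_⟩
  have h0 : (0 : ℝ) ∈ Ico 0 T₁ := ⟨le_rfl, hT₂.trans hT₂₁⟩
  obtain ⟨-, hus, hθs⟩ := isHardSphereEulerSolution_isSmooth_slice hE₁ h0
  have hzero : ∀ {G : Type} [NormedAddCommGroup G] [NormedSpace ℝ G] (g : T3 → G),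
      ∀ n : ℕ, n ≤ k → ∀ y : EuclideanSpace ℝ (Fin 3),
        ‖iteratedFDeriv ℝ n (Torus.lift fun x => g x - g x) y‖ ≤ δ := by
    intro G _ _ g n _ y
    have hl : (Torus.lift fun x => g x - g x) = fun _ => (0 : G) := by
      funext z; simp [Torus.lift]
    rw [hl, iteratedFDeriv_fun_zero]
    simpa using hδ.le
  obtain ⟨T, hT, ρ, θ, u, hE, hρ0, hu0, hθ0, hclose⟩ :=
    H σ hσ hσδ ρ₀ (θ₁ 0) (u₁ 0) hρ₀ hθs hus hρ₀pos (hE₁.temperature_pos 0 h0) hdata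
      (hzero (θ₁ 0)) (hzero (u₁ 0))
  exact ⟨T, hT, ρ, θ, u, hE, hρ0, hu0, hθ0, fun t ht x => (hclose t ht x).1⟩

/-- **`ImplosionDichotomy.EosContinuity`** (route support item stmt-AtomisticToContinuum-12589), conditional
on the named fact `hsEuler_continuousDependence` (Kato 1975 Thm III for the hard-sphere Euler family): the
rest is the unconditional reduction `eosContinuity_of_nearIdealStability`. [folklore] -/
theorem eosContinuity_proof (h : hsEuler_continuousDependence) : EosContinuity :=
  eosContinuity_of_nearIdealStability (nearIdealStability_of_continuousDependence h)

end Summit.AtomisticToContinuum.HydrodynamicLimit.Theorems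

end
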